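import Mathlib
import HarnessLib

/-!
# Crux `SAWDevelopingMap.ObservableToSLE` (stmt-CriticalPhenomena-10472), line `six-class-type-ladder`,
stub T2b `stub_carvedReduction` (= twin stub 5a4 of stmt-CriticalPhenomena-14005): piece (G6b),
SPLICING SEQUENCE DATA INTO MESH-INDEXED FAMILIES

Landing target:
`Summits/CriticalPhenomena/SAWScalingLimit/Theorems/SAWDevelopingMapObservableToSLETypeLadderCarvedReductionSplice.lean`
(`--supports stmt-CriticalPhenomena-10472`; registered sub-goal `stub_carvedReduction_splice`).

The fixed-domain identification T2a and the restriction limit ARL″ speak about lattice families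
INDEXED BY THE MESH `δ : ℝ` (`Λ : ℝ → Finset HexVertex`, gate mid-edges `a b : ℝ → Sym2 HexVertex`,
thresholds `m : ℝ → ℤ`) with hypotheses along the filter `𝓝[>] 0`, while the moving-carving
squeeze produces its pinned data along a SEQUENCE of meshes `s j → 0⁺`.  After passing to a
strictly decreasing subsequence of meshes (`exists_strictAnti_subseq`), sequence data `v j` at the
meshes `s j` and a default mesh-indexed family `g δ` are SPLICED into one mesh-indexed family
(`splice s v g δ = v j` if `δ = s j`, `= g δ` otherwise; written with `Classical.choose`, no new
definition): `splice_apply_seq`, `splice_apply_of_forall_ne`; eventual properties and limits along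
`𝓝[>] 0` hold for the spliced family as soon as they hold for the sequence data (eventually in `j`)
and for the default family (`eventually_splice`, `tendsto_splice`); `stub_carvedReduction_splice`
packages the two transfer statements.
-/

noncomputable section

open scoped Topology Classical
open Filter Set

namespace Summit.CriticalPhenomena.SAWScalingLimit.Theorems.ObservableToSLE.TypeLadder

/-! ### Strictly decreasing subsequences of meshes -/

/-- A sequence of meshes tending to `0` inside `(0, ∞)` has a strictly decreasing subsequence. -/
theorem exists_strictAnti_subseq {s : ℕ → ℝ} (hs : Tendsto s atTop (𝓝[>] 0)) :
    ∃ φ : ℕ → ℕ, StrictMono φ ∧ StrictAnti (s ∘ φ) ∧ ∀ j, 0 < s (φ j) := by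
  have hpos : ∀ᶠ n in atTop, 0 < s n := hs.eventually eventually_mem_nhdsWithin
  have hs0 : Tendsto s atTop (𝓝 0) := tendsto_nhds_of_tendsto_nhdsWithin hs
  -- from any index with positive mesh, a later index with smaller positive mesh
  have hnext : ∀ n, 0 < s n → ∃ m, n < m ∧ 0 < s m ∧ s m < s n := by
    intro n hn
    have h1 : ∀ᶠ m in atTop, s m < s n := (tendsto_order.1 hs0).2 _ hn
    obtain ⟨m, hm⟩ := (((eventually_gt_atTop n).and hpos).and h1).exists
    exact ⟨m, hm.1.1, hm.1.2, hm.2⟩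
  obtain ⟨n₀, hn₀⟩ := hpos.exists
  choose! nx hnx using hnext
  -- iterate
  let φ : ℕ → ℕ := fun j => Nat.rec n₀ (fun _ n => nx n) j
  have hφpos : ∀ j, 0 < s (φ j) := by
    intro j
    induction j with
    | zero => exact hn₀
    | succ j ih => exact (hnx _ ih).2.1
  have hφlt : ∀ j, φ j < φ (j + 1) := fun j => (hnx _ (hφpos j)).1
  have hslt : ∀ j, s (φ (j + 1)) < s (φ j) := fun j => (hnx _ (hφpos j)).2.2
  exact ⟨φ, strictMono_nat_of_lt_succ hφlt, strictAnti_nat_of_succ_lt hslt, hφpos⟩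

/-! ### Splicing -/

section Splice

variable {β : Type*} {s : ℕ → ℝ} (hs : StrictAnti s)

include hs

/-- The spliced family takes the sequence value at a mesh of the sequence. -/
theorem splice_apply_seq (v : ℕ → β) (g : ℝ → β) (j : ℕ) :
    (if h : ∃ i, s i = s j then v h.choose else g (s j)) = v j := by
  have h : ∃ i, s i = s j := ⟨j, rfl⟩
  rw [dif_pos h]
  congr 1
  exact hs.injective h.choose_spec

omit hs in
/-- The spliced family takes the default value off the sequence. -/
theorem splice_apply_of_forall_ne (v : ℕ → β) (g : ℝ → β) {δ : ℝ} (hδ : ∀ i, s i ≠ δ) :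
    (if h : ∃ i, s i = δ then v h.choose else g δ) = g δ := by
  have h : ¬ ∃ i, s i = δ := fun ⟨i, hi⟩ => hδ i hi
  rw [dif_neg h]

/-- Small meshes of a strictly decreasing positive sequence have large indices. -/
theorem exists_lt_of_lt (hspos : ∀ j, 0 < s j) (J : ℕ) :
    ∃ t > (0 : ℝ), ∀ j, s j < t → J ≤ j := by
  refine ⟨s J, hspos J, fun j hj => ?_⟩
  by_contra h
  exact absurd hj (not_lt.2 (hs.antitone (Nat.le_of_lt (not_le.1 h))))

/-- **Eventual properties of the spliced family**: if `P (s j) (v j)` holds for all large `j` and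
`P δ (g δ)` for all small `δ > 0`, then `P δ (splice δ)` for all small `δ > 0`. -/
theorem eventually_splice (hspos : ∀ j, 0 < s j) {P : ℝ → β → Prop} {v : ℕ → β} {g : ℝ → β}
    (hv : ∀ᶠ j in atTop, P (s j) (v j)) (hg : ∀ᶠ δ in 𝓝[>] (0 : ℝ), P δ (g δ)) :
    ∀ᶠ δ in 𝓝[>] (0 : ℝ), P δ (if h : ∃ i, s i = δ then v h.choose else g δ) := by
  obtain ⟨J, hJ⟩ := eventually_atTop.1 hv
  obtain ⟨t, ht, hJt⟩ := exists_lt_of_lt hs hspos J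
  have hsmall : ∀ᶠ δ in 𝓝[>] (0 : ℝ), δ < t :=
    mem_nhdsWithin_of_mem_nhds (Iio_mem_nhds ht)
  filter_upwards [hg, hsmall] with δ hgδ hδt
  by_cases h : ∃ i, s i = δ
  · obtain ⟨i, rfl⟩ := h
    rw [splice_apply_seq hs]
    exact hJ i (hJt i hδt)
  · rw [splice_apply_of_forall_ne v g (fun i hi => h ⟨i, hi⟩)]
    exact hgδ

/-- **Limits of the spliced family**: if `F (s j) (v j) → l` and `F δ (g δ) → l` as `δ → 0⁺`,
then `F δ (splice δ) → l` as `δ → 0⁺`. -/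
theorem tendsto_splice {γ : Type*} (hspos : ∀ j, 0 < s j)
    {F : ℝ → β → γ} {l : Filter γ} {v : ℕ → β} {g : ℝ → β}
    (hv : Tendsto (fun j => F (s j) (v j)) atTop l) (hg : Tendsto (fun δ => F δ (g δ)) (𝓝[>] (0 : ℝ)) l) :
    Tendsto (fun δ => F δ (if h : ∃ i, s i = δ then v h.choose else g δ)) (𝓝[>] (0 : ℝ)) l := by
  rw [tendsto_def]
  intro U hU
  have hv' : ∀ᶠ j in atTop, F (s j) (v j) ∈ U := hv hU
  have hg' : ∀ᶠ δ in 𝓝[>] (0 : ℝ), F δ (g δ) ∈ U := hg hU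
  exact eventually_splice hs hspos (P := fun δ b => F δ b ∈ U) hv' hg'

end Splice

/-- **Registered sub-goal `stub_carvedReduction_splice`** (crux item stmt-CriticalPhenomena-10472,
stub T2b `stub_carvedReduction`, piece (G6b) SPLICING): along a strictly decreasing positive
sequence of meshes, eventual properties and limits as `δ → 0⁺` of the family spliced from sequence
data `v` and a default family `g` follow from those of `v` (eventually in `j`) and of `g`. -/
theorem stub_carvedReduction_splice :
    ∀ (β γ : Type) (s : ℕ → ℝ) (v : ℕ → β) (g : ℝ → β), StrictAnti s → (∀ j, 0 < s j) →
      (∀ j, (if h : ∃ i, s i = s j then v h.choose else g (s j)) = v j) ∧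
      (∀ P : ℝ → β → Prop, (∀ᶠ j in atTop, P (s j) (v j)) → (∀ᶠ δ in 𝓝[>] (0 : ℝ), P δ (g δ)) →
        ∀ᶠ δ in 𝓝[>] (0 : ℝ), P δ (if h : ∃ i, s i = δ then v h.choose else g δ)) ∧
      (∀ (F : ℝ → β → γ) (l : Filter γ), Tendsto (fun j => F (s j) (v j)) atTop l →
        Tendsto (fun δ => F δ (g δ)) (𝓝[>] (0 : ℝ)) l →
        Tendsto (fun δ => F δ (if h : ∃ i, s i = δ then v h.choose else g δ)) (𝓝[>] (0 : ℝ)) l) := by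
  intro β γ s v g hs hspos
  exact ⟨fun j => splice_apply_seq hs v g j, fun P hv hg => eventually_splice hs hspos hv hg,
    fun F l hv hg => tendsto_splice hs hspos hv hg⟩

end Summit.CriticalPhenomena.SAWScalingLimit.Theorems.ObservableToSLE.TypeLadder

end
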